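import Literature.MathematicalPhysics.QuantumFieldTheory.Balaban1983to89.B1Eq324BenfattoClassSectEMemberPrecisionDoorOnLambdaStarSmall

/-!
# `Balaban1983to89.B1Eq324BenfattoClassSectEMemberPrecisionDoorRowsByNameStar` — THE (3.24) PRECISION DOOR OF RECORD AT NODE 00's STAR SECT. E LETTERS,
# GENERAL SMALL BACKGROUND, WITH node N06's ROWS BY NAME: the P-row as N06's numbered row 26 ∕ its printed family form, the 𝒥-row along (3.136) from the
# adjoint current, [5]'s reality as letter properties (seat dag-n08-d g40, INTENT-99 as re-scoped by seat dag-n08-b's SPLIT; node N08 [Balaban1985UV3], row `h324c` at `U ≠ 1`)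

statement-level companion of published sources with citation tags; every declaration here is a theorem; nothing here is a claim about the
Yang–Mills mass gap

T. Bałaban, *Ultraviolet stability of three-dimensional lattice pure gauge field theories*, Commun. Math. Phys. **102** (1985) 255–275 [Balaban1985UV3], (24) p. 262;
*Propagators for lattice gauge theories in a background field*, CMP **99** (1985) 389–434 [Balaban1985BackgroundPropagators] (= [B9]), Sect. E (3.155)–(3.158)
pp. 427–428, (3.132) ∕ (3.136) p. 422, (3.35)–(3.36) p. 396, (3.40) p. 397; *Averaging operations for lattice gauge theories*, CMP **98** (1985) 17–51 [Balaban1985Averaging]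
(= [5]), (125)–(126) p. 36, (136) p. 39; *Propagators … II*, CMP **96** (1984) 223–250 [Balaban1984PropagatorsII] (= [4]), (2.3) p. 224, Lemma 2.4 p. 245, (2.149) p. 249,
(2.153)–(2.156) pp. 249–250; *(Higgs)₂,₃ quantum fields in a finite volume. I*, CMP **85** (1982) 603–636 [Balaban1982Higgs1], (3.24) p. 616; G. Benfatto et al.,
CMP **59** (1978) 143–166 [BenfattoEtAl1978], Lemma (4.5)–(4.7) p. 152.

THE PRINTED LOCUS.  [B9] Sect. E p. 428: *"This form is considered on the subspace {B : B = 0 on Λᶜ, …} … B = CB̃ … (C\*Δ_kC)⁻¹ = C̃^{(k)}(Λ) … a lower bound γ₀ > 0 …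
localizing … methods of Sect. B"*, with [4] (2.3) p. 224 ∕ Lemma 2.4 p. 245 (the STAR variable set: bonds with at least one end-point in `Λ`); [B10] (24) p. 262: the
cumulant bound for `dμ_{C^{(k)}}` via [Balaban1982Higgs1] (3.24) ∕ [BenfattoEtAl1978] Lemma (4.5)–(4.7).

WHY THIS FILE.  Seat dag-n08-b's door of record at the STAR letters, general background `U` —
`…PrecisionDoorOnLambdaStar.eq324_CsDeltaCPstY_sectEStYOfRecordV7_trBasis_of_units_onΛst_on_unit` (p702005 §4) — discharges NODE 00's structural rows and DISPLAYS,
in star currency: [5]'s reality of `Δ⁽²⁾(U)`, `⟨D̃⁽²⁾·,J⟩(U)`; node N06's P-row (3.132) and 𝒥-row (3.136) between STAR bonds; NODE 00's star pivot units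
`IsUnit (KstY …) ∕ IsUnit (KTstY …)` with a pivot-inverse row `κ_K`; the Δ_k-row `γ₀` (G-B9-09).  At `U = 1` every row is a theorem (p702939).  At `U ≠ 1` the
SOURCE-convention lineage already keys the displayed rows to NAMED statements (`…PrecisionDoorRowsByName` §5–§6, p680757: node N06's numbered row 26
`B9.Ineq3132 …` ∕ its family form `B9.Stmt3132Printed …` for the P-row, the adjoint-current route (3.136) for the 𝒥-row), but on def-Y's SOURCE subspace, where the
`γ₀` row is not print's (CHECK-L).  Seat dag-n08-b's `…PrecisionDoorOnLambdaStarSmall` §1 (INTENT-24) discharges NODE 00's three star pivot rows of p702005 §4 in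
print's small-field regime ([B9] (3.35) ∕ (3.40): `‖V(b) − 1‖ ≤ δ_V` on the unit bonds of the averaged field of record, `L^{d+1}·2δ_V(L + (d+1)ℓ) < 1`; this lineage's
`Node00.OpsYSectEElimStarSmall.isUnit_K[T]stY_of_smallVY`, `…ERowsAtNode00StarSmall.norm_inverse_KstY_apply_le_of_smallVY`, `κ_K := (1 − κ)⁻¹`) and keys the P-row to
node N06's row 26 with the 𝒥-row displayed RAW.  THIS FILE re-keys p680757 §5–§6 AT THE STAR LETTERS over that small door — the 𝒥-row along print's (3.136) route
from the adjoint current, [5]'s reality as letter properties, the class-parametric family form: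
* §1 ★★ `JRowPrint_sectEYWithDt2_of_adjCurrent_onΛst` — the print-unit 𝒥-row on STAR pairs from the adjoint current (this lineage's
  `…JRowCompositionAtNode00.JRowPrint_sectEYWithDt2_of_adjCurrent_at`, output-support row asked on STAR pairs only).
* §2 ★★★ `eq324_CsDeltaCPstY_sectEStYOfRecordV7_trBasis_of_ineq3132_of_adjCurrent_of_small_onΛst_on_unit` — p680757 §5 at the star letters: records
  `lettersYOfRecordV4 N θ M⋆ (resYOfC2 𝔠) x` ∕ `sectEStYOfRecordV7 N θ M⋆ (sectEYWithDt2 N θ M⋆ (resYOfC2 𝔠) 𝔡₂ 𝔢₀) x`; per background: the small-field row, [5]'s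
  reality of `C⁽²⁾(U)`, `D̃⁽²⁾(U)` (`form … star`), node N06's row 26 `B9.Ineq3132 (d+1) ((opsYNuOfRecordV4E … (resYOfC2 𝔠) 𝔢 𝔴 𝔈 x).QG1Qinv) B_P δ U` (→ the P-row on
  STAR pairs by this lineage's `…PRowDictionaryAtNode00.pRowOnΛst_opsYNuOfRecordV4E_of_ineq3132`), (b†) the print-unit sup of `H₁(U)†J(U)` on a support predicate
  `S`, (c-out) on STAR pairs, (c) argument locality ∕ size of `D̃⁽²⁾` (→ the 𝒥-row by §1), the Δ_k-row `γ₀` on print's STAR subspace — ONE `obtain ∕ exact` over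
  seat dag-n08-b's `…PrecisionDoorOnLambdaStarSmall.eq324_CsDeltaCPstY_sectEStYOfRecordV7_trBasis_of_small_onΛst_on_unit`.
* §3 ★★★ `eq324_CsDeltaCPstY_sectEStYOfRecordV7_trBasis_of_stmt3132Printed_R_of_adjCurrent_of_small_onΛst_on_unit` — p680757 §6 at the star letters: the family
  form at def-Y's class-parametric carrier `bg9YR SU(N) R₁ R₂` (hypothesis = n06-i's edition-8 row-26 face type `B9.Stmt3132Printed …`; thresholds `M₄, a₀`, ONE
  rate; `U` is `SU(N)`-valued by `mem_of_reg335R`).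

HONEST SCOPE.  Count-neutral Literature theorems, typed compositions BY NAME of landed pieces (dag-n08-b's small star door over p702005 §4 ∕ p701836 ∕ p702840,
p693403 §6, p680120, def-Y's `resYOfC2_Δ2_isSymmTr_real` ∕ `sectEYWithDt2_D2J_isSymmTr_ofC2`, `mem_of_reg335R`).  REGIME: the small-field row is a hypothesis on
the averaged field OF RECORD
`‖V(b) − 1‖ ≤ δ_V` (gauge-variant; print's (3.35) is small curvature and passes to small fields on blocks after the axial gauge, (3.40) p. 397 — that passage is NOT
taken here; the plaquette-smallness twin of the source lineage is unavailable at STAR corners whose source block is not good).  Nothing of node N06 asserted: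
(3.132) enters as the HYPOTHESIS `B9.Ineq3132 …` ∕ `B9.Stmt3132Printed …`, the sup of the adjoint current, the output support ∕ locality ∕ size of `D̃⁽²⁾` and `γ₀`
(G-B9-09, [B9] p. 428 «methods of Sect. B») are DISPLAYED rows.  The IDENT for row `h324c` (NODE 00's pin `(𝔖 k).μ = 𝒩(0, 𝕄_Λ̃st(η^{d+1}C_st\*Δ_kC_st)⁻¹).map Φ`, box,
class-II letters, window `b₁ < b₀`) is NOT made; node N06 ∕ N08 NOT discharged; nothing of [Balaban1985UV3] ∕ [Balaban1985BackgroundPropagators] ∕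
[Balaban1985Averaging] ∕ [Balaban1984PropagatorsII] ∕ [Balaban1982Higgs1] ∕ [BenfattoEtAl1978] is asserted beyond what the tree proves; nothing about `d = 4`
specifically, the continuum, OS axioms, a mass gap or Clay.  No `sorry`, no `def`, no `instance`, no `notation`.
-/

noncomputable section

open MeasureTheory Finset Matrix

namespace Literature.MathematicalPhysics.QuantumFieldTheory.Balaban1983to89.B1Eq324BenfattoClassSectEMemberPrecisionDoorRowsByNameStar

open Literature.MathematicalPhysics.QuantumFieldTheory
open Literature.MathematicalPhysics.QuantumFieldTheory.Balaban1983to89.B1Eq324BenfattoLemma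
open Literature.MathematicalPhysics.QuantumFieldTheory.Balaban1983to89.B9PinMembersKLevelV1 (MemberY geo9Y bg9Y)
open Literature.MathematicalPhysics.QuantumFieldTheory.Balaban1983to89.B9PinGeometryKLevelV1 (unitDistY)
open Literature.MathematicalPhysics.QuantumFieldTheory.Balaban1983to89.Node00

variable {N : ℕ}

/-! ## §1 The print-unit 𝒥-row on STAR pairs from the adjoint current (star twin of `…JRowCompositionAtNode00.JRowPrint_sectEYWithDt2_of_adjCurrent_onΛ`) -/

section JRowStar

open scoped Matrix.Norms.L2Operator
open B1Eq324BenfattoClassSectEMemberJRowCompositionAtNode00 (JRowPrint_sectEYWithDt2_of_adjCurrent_at)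

variable (θ : Stage3Params) (Mstar' : ℕ) (𝔯 : ResY N θ Mstar') (𝔡₂ : Dt2Y N θ Mstar') (𝔢₀ : SectEY N θ Mstar')

/-- ★★ **THE PRINT-UNIT `𝒥`-ROW OF THE STAR DOOR FROM THE ADJOINT CURRENT, OUTPUT-SUPPORT ROW ON STAR BONDS ONLY** — the star twin of this lineage's
`JRowPrint_sectEYWithDt2_of_adjCurrent_onΛ` (`inΛY ↦ inΛstY`, [4] (2.3) p. 224: bonds with at least one end block in `Λ′`): for every member `x`, background `U`,
rate `δ ≥ 0` and all STAR bonds `u, v`, `‖((λ_x : ℂ) • (a + ⟨D̃⁽²⁾·,J⟩(U)))(δ_v ⊗ E)(u)‖ ≤ (θ.b₁ + 2N³·j₁·C₂·e^{δr₂})·‖E‖·e^{−δ|y_u − y_v|}` at the v8 letters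
`sectEYWithDt2 N θ M⋆ 𝔯 𝔡₂ 𝔢₀`, GIVEN (b†) the print-unit sup of the adjoint current `H₁(U)†J(U)` on a support predicate `S`, (c-out) the output support of
`D̃⁽²⁾(U; δ_v ⊗ E, δ_u ⊗ a)` in `S` for STAR `u, v`, (c) argument locality `r₂` and size `C₂` of `D̃⁽²⁾` (from `…_at`, one pair at a time).
[cite: Balaban1985BackgroundPropagators, (3.156) p.428, (3.136) p.422, (3.129) p.421, p.427; Balaban1985Averaging, (136) p.39; Balaban1984PropagatorsII, (2.3) p.224,
(2.14) p.225; BenfattoEtAl1978, Lemma (4.5)–(4.7) p.152 (class form); Balaban1985UV3, (24) p.262] -/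
theorem JRowPrint_sectEYWithDt2_of_adjCurrent_onΛst (hD : 2 ≤ θ.d₆ + 1) (x : MemberY θ.d₆ θ.ℓ₆ θ.hd' θ.hL' θ.b₀ θ.b₁ Mstar')
    [DecidableEq (IBondY x.toKIdx)] (U : CfgY (Matrix (Fin N) (Fin N) ℂ) x.toKIdx) (S : IBondY x.toKIdx → Prop) {j₁ C₂ r₂ δ : ℝ}
    (hj₁ : 0 ≤ j₁) (hC₂ : 0 ≤ C₂) (hδ : 0 ≤ δ)
    (hHJ : ∀ z, S z → ((((θ.ℓ₆ + 1 : ℕ) : ℝ)) ^ x.k)⁻¹ ^ (θ.d₆ + 1) *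
      ‖trAdjY (trDualMatY N) ((lettersYOfRecordV4 N θ Mstar' 𝔯 x).H₁ U) (JY x.toKIdx U) z‖ ≤ j₁)
    (hDsupp : ∀ (u v : IBondY x.toKIdx) (E a : Matrix (Fin N) (Fin N) ℂ) (z : IBondY x.toKIdx), inΛstY x u → inΛstY x v →
      (𝔡₂ x).form U (Pi.single v E) (Pi.single u a) z ≠ 0 → S z)
    (hDloc : ∀ (u v : IBondY x.toKIdx) (E a : Matrix (Fin N) (Fin N) ℂ), r₂ < unitDistY x u v → (𝔡₂ x).form U (Pi.single v E) (Pi.single u a) = 0)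
    (hDsz : ∀ (u v : IBondY x.toKIdx) (E a : Matrix (Fin N) (Fin N) ℂ), ∑ z, ‖(𝔡₂ x).form U (Pi.single v E) (Pi.single u a) z‖ ≤ C₂ * ‖E‖ * ‖a‖) :
    ∀ (u v : IBondY x.toKIdx) (E : Matrix (Fin N) (Fin N) ℂ), inΛstY x u → inΛstY x v →
      ‖(((((((θ.ℓ₆ + 1 : ℕ) : ℝ)) ^ x.k)⁻¹ ^ (θ.d₆ + 1) : ℝ) : ℂ) •
          (aY x.toKIdx + (sectEYWithDt2 N θ Mstar' 𝔯 𝔡₂ 𝔢₀ x).D2J U)).restrictScalars ℝ (Pi.single v E) u‖ ≤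
        (θ.b₁ + 2 * (N : ℝ) ^ 3 * j₁ * C₂ * Real.exp (δ * r₂)) * ‖E‖ * Real.exp (-(δ * unitDistY x u v)) :=
  fun u v E hu hv => JRowPrint_sectEYWithDt2_of_adjCurrent_at θ Mstar' 𝔯 𝔡₂ 𝔢₀ hD x U S hj₁ hC₂ hδ hHJ u v E
    (fun a z h => hDsupp u v E a z hu hv h) (hDloc u v E) (hDsz u v E)

end JRowStar

/-! ## §2 Per background, rows BY NAME at the star letters: node N06's numbered row 26 for the P-row, the adjoint-current route (3.136) for the 𝒥-row,
[5]'s reality, the small-field regime — p680757 §5 re-keyed -/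

section RowsByNameStar

open scoped Matrix.Norms.L2Operator
open B7Prop2Explicit (unitaryUnits)
open B9Thm311ReadingCoords (trIP IsSymmTr)
open B9CoReadingCoordsTranspose (trReForm TrIdx trBasis)
open B9Eq3132NuReading (opsYNuOfRecordV4E)
open B1Eq324BenfattoClassSectEMemberPRowDictionaryAtNode00 (pRowOnΛst_opsYNuOfRecordV4E_of_ineq3132)
open B1Eq324BenfattoClassSectEMemberJRowCompositionAtNode00 (KJadj_nonneg)
open B1Eq324BenfattoClassSectEMemberPrecisionDoorOnLambdaStarSmall (eq324_CsDeltaCPstY_sectEStYOfRecordV7_trBasis_of_small_onΛst_on_unit)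

/-- ★★★ **THE STAR DOOR WITH BOTH N06-SIDE ROWS BY NAME, PER SMALL BACKGROUND, 𝒥-ROW ALONG (3.136)** — p680757 §5
`…PrecisionDoorRowsByName.eq324_CsDeltaCPY_opsYOfRecordV8E_trBasis_of_ineq3132_of_adjCurrent_onΛ_on_unit` RE-KEYED AT THE STAR LETTERS: records
`lettersYOfRecordV4 N θ M⋆ (resYOfC2 𝔠) x` (the residual family read off [5]'s `C⁽²⁾`) and `sectEStYOfRecordV7 N θ M⋆ (sectEYWithDt2 N θ M⋆ (resYOfC2 𝔠) 𝔡₂ 𝔢₀) x`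
(the v7 STAR record over the v8 letters `D2J := d2JOfY` of [5]'s `D̃⁽²⁾`); `G ≤ U(N)`, `G`-valued `U`.  DISPLAYED per background: the small-field row
`‖V(b) − 1‖ ≤ δ_V` of the averaged field of record (seat dag-n08-b's `…PrecisionDoorOnLambdaStarSmall` §1), [5]'s reality of `C⁽²⁾(U)`, `D̃⁽²⁾(U)` (`form U (A⋆) (A′⋆) = (form U A A′)⋆`; → the two `IsSymmTr` rows by
def-Y's `resYOfC2_Δ2_isSymmTr_real` ∕ `sectEYWithDt2_D2J_isSymmTr_ofC2`), node N06's numbered row 26 at `U`,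
`B9.Ineq3132 (d+1) ((opsYNuOfRecordV4E N θ M⋆ (resYOfC2 𝔠) 𝔢 𝔴 𝔈 x).QG1Qinv) B_P δ U` (→ the P-row on STAR pairs by this lineage's
`pRowOnΛst_opsYNuOfRecordV4E_of_ineq3132`: on top-level bonds `ν(u)ν(v) = η^{d+1}`, `Lʲη = 1`), for a support predicate `S` (the suppliers' choice): (b†)
`η^{d+1}·‖(H₁(U)†J(U))(z)‖ ≤ j₁` on `S`, (c-out) for STAR `u, v` the output `D̃⁽²⁾(U; δ_v ⊗ E, δ_u ⊗ a)` is supported in `S`, (c) argument-locality radius `r₂` and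
size `C₂` of `D̃⁽²⁾(U)` (→ the 𝒥-row by §1, `K_J := θ.b₁ + 2N³·j₁·C₂·e^{δr₂}` at the P-row's rate), and the Δ_k-row `γ₀` on print's STAR subspace for `deltaKPstY … U`
(G-B9-09).  Conclusion (3.24) for `𝒩(0, 𝕄_ι(CsDeltaCPstY … U)⁻¹)`.
[cite: Balaban1985BackgroundPropagators, (3.35) p.396, (3.40) p.397, (3.132) p.422, (3.136) p.422, Thm 3.12 p.423, p.427, (3.117) p.419, (3.156)–(3.158) p.428,
Thm 3.11 p.416; Balaban1985Averaging, (125)–(126) p.36, (136) p.39; Balaban1984PropagatorsII, (2.3) p.224, Lemma 2.4 p.245, (2.149) p.249, (2.153)–(2.156) pp.249–250;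
Balaban1985UV3, (24) p.262, pp.271–272; Balaban1982Higgs1, (3.24) p.616; BenfattoEtAl1978, Lemma (4.5)–(4.7) p.152 (class form; bent window, presentation and
coordinates ours)] -/
theorem eq324_CsDeltaCPstY_sectEStYOfRecordV7_trBasis_of_ineq3132_of_adjCurrent_of_small_onΛst_on_unit (N : ℕ) [NeZero N] (θ : Stage3Params)
    (hD : 2 ≤ θ.d₆ + 1) (Mstar : ℕ) (𝔠 : C2Y N θ Mstar) (𝔡₂ : Dt2Y N θ Mstar) (𝔢₀ 𝔢 : SectEY N θ Mstar) (𝔴 : RWEY N θ Mstar) (𝔈 : ExpsY N θ Mstar)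
    {γ₀ BP δ δV j₁ C₂ r₂ : ℝ} (hγ₀ : 0 < γ₀) (hBP : 0 ≤ BP) (hδ : 0 < δ) (hδV : 0 ≤ δV) (hj₁ : 0 ≤ j₁) (hC₂ : 0 ≤ C₂)
    (hsmallV : (((θ.ℓ₆ + 1 : ℕ) : ℝ)) ^ (θ.d₆ + 1) * (2 * δV * (((θ.ℓ₆ + 1 : ℕ) + (θ.d₆ + 1) * θ.ℓ₆ : ℕ) : ℝ)) < 1)
    (t D : ℕ) {ϰ : ℝ} (hϰ : 0 < ϰ) {p₀ σ' c κ' : ℝ} (hp₀ : 2 / 3 < p₀) (hσ : 0 < σ') (hc : 0 ≤ c) (hκ : 0 < κ') (hκσ : κ' < σ' * (t + 1)) :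
    ∃ b₁ : ℝ, ∀ b₀ : ℝ, b₁ < b₀ → ∃ C : ℝ, 0 ≤ C ∧ ∀ η : ℝ, 0 < η → η ≤ 1 →
      ∀ (x : MemberY θ.d₆ θ.ℓ₆ θ.hd' θ.hL' θ.b₀ θ.b₁ Mstar) [DecidableEq (IBondY x.toKIdx)]
        {G : Subgroup (Matrix (Fin N) (Fin N) ℂ)ˣ}, G ≤ unitaryUnits (Matrix (Fin N) (Fin N) ℂ) →
      ∀ (U : CfgY (Matrix (Fin N) (Fin N) ℂ) x.toKIdx), (∀ μ z, U μ z ∈ G) →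
        (∀ b : UBondY x, ‖((avYOfRecord x U b : (Matrix (Fin N) (Fin N) ℂ)ˣ) : Matrix (Fin N) (Fin N) ℂ) - 1‖ ≤ δV) →
        (∀ A A' : FBondY x.toKIdx → Matrix (Fin N) (Fin N) ℂ, (𝔠 x).form U (star A) (star A') = star ((𝔠 x).form U A A')) →
        (∀ B B' : IBondY x.toKIdx → Matrix (Fin N) (Fin N) ℂ, (𝔡₂ x).form U (star B) (star B') = star ((𝔡₂ x).form U B B')) →
      ∀ {σ : Type} [Fintype σ] [DecidableEq σ] [Nonempty σ] (ι : σ → IBondY x.toKIdx), Function.Injective ι → (∀ s, lamTstY x (ι s)) →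
        B9.Ineq3132 (θ.d₆ + 1) (opsYNuOfRecordV4E N θ Mstar (resYOfC2 N θ Mstar 𝔠) 𝔢 𝔴 𝔈 x).QG1Qinv BP δ U →
      ∀ (S : IBondY x.toKIdx → Prop),
        (∀ z, S z → etaDY x * ‖trAdjY (trDualMatY N) ((lettersYOfRecordV4 N θ Mstar (resYOfC2 N θ Mstar 𝔠) x).H₁ U) (JY x.toKIdx U) z‖ ≤ j₁) →
        (∀ (u v : IBondY x.toKIdx) (E a : Matrix (Fin N) (Fin N) ℂ) (z : IBondY x.toKIdx), inΛstY x u → inΛstY x v →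
          (𝔡₂ x).form U (Pi.single v E) (Pi.single u a) z ≠ 0 → S z) →
        (∀ (u v : IBondY x.toKIdx) (E a : Matrix (Fin N) (Fin N) ℂ), r₂ < unitDistY x u v → (𝔡₂ x).form U (Pi.single v E) (Pi.single u a) = 0) →
        (∀ (u v : IBondY x.toKIdx) (E a : Matrix (Fin N) (Fin N) ℂ), ∑ z, ‖(𝔡₂ x).form U (Pi.single v E) (Pi.single u a) z‖ ≤ C₂ * ‖E‖ * ‖a‖) →
        (∀ B : IBondY x.toKIdx → Matrix (Fin N) (Fin N) ℂ, (∀ q, ¬ inΛstY x q → B q = 0) → (∀ q, IsAxialY x q → B q = 0) →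
          (∀ c' : CBondStY x, Q1Y x (avYOfRecord x) U c'.1 B = 0) →
          γ₀ * trIP (fun _ => (1 : ℝ)) B B ≤
            trIP (fun _ => (1 : ℝ)) B (deltaKPstY x (lettersYOfRecordV4 N θ Mstar (resYOfC2 N θ Mstar 𝔠) x)
              (sectEStYOfRecordV7 N θ Mstar (sectEYWithDt2 N θ Mstar (resYOfC2 N θ Mstar 𝔠) 𝔡₂ 𝔢₀) x) U B)) →
      ∃ (Λ : Finset (B1Eq324BenfattoLemma.Site (θ.d₆ + 1 + (θ.d₆ + 1) + 1))) (e' : σ × TrIdx N ≃ ↥Λ),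
        ((gaussianFieldOfKernel fun u w => if h : u ∈ Λ ∧ w ∈ Λ then
            ((Matrix.reindex e' e'
              (Matrix.of fun p q : σ × TrIdx N =>
                  trReForm (trBasis N p.2) (((CsDeltaCPstY x (lettersYOfRecordV4 N θ Mstar (resYOfC2 N θ Mstar 𝔠) x)
            (sectEStYOfRecordV7 N θ Mstar (sectEYWithDt2 N θ Mstar (resYOfC2 N θ Mstar 𝔠) 𝔡₂ 𝔢₀) x) U).restrictScalars ℝ)
                    (Pi.single (ι q.1) (trBasis N q.2)) (ι p.1))))⁻¹ :
                Matrix ↥Λ ↥Λ ℝ) ⟨u, h.1⟩ ⟨w, h.2⟩ else 0).map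
            (fun (z : B1Eq324BenfattoLemma.Site (θ.d₆ + 1 + (θ.d₆ + 1) + 1) → ℝ) (q : σ × TrIdx N) => z ((e' q : ↥Λ) : B1Eq324BenfattoLemma.Site (θ.d₆ + 1 + (θ.d₆ + 1) + 1))) =
          gaussianFieldOfKernel fun p q =>
            ((Matrix.of fun p q : σ × TrIdx N =>
                trReForm (trBasis N p.2) (((CsDeltaCPstY x (lettersYOfRecordV4 N θ Mstar (resYOfC2 N θ Mstar 𝔠) x)
            (sectEStYOfRecordV7 N θ Mstar (sectEYWithDt2 N θ Mstar (resYOfC2 N θ Mstar 𝔠) 𝔡₂ 𝔢₀) x) U).restrictScalars ℝ)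
                  (Pi.single (ι q.1) (trBasis N q.2)) (ι p.1)))⁻¹ :
              Matrix (σ × TrIdx N) (σ × TrIdx N) ℝ) p q) ∧
        (∀ p : ℝ, 0 ≤ p →
          ((fun (z : B1Eq324BenfattoLemma.Site (θ.d₆ + 1 + (θ.d₆ + 1) + 1) → ℝ) (q : σ × TrIdx N) => z ((e' q : ↥Λ) : B1Eq324BenfattoLemma.Site (θ.d₆ + 1 + (θ.d₆ + 1) + 1))) ⁻¹'
              {ω : σ × TrIdx N → ℝ | ∀ q, |ω q| ≤ p}) =ᵐ[gaussianFieldOfKernel fun u w => if h : u ∈ Λ ∧ w ∈ Λ then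
                ((Matrix.reindex e' e'
                  (Matrix.of fun p q : σ × TrIdx N =>
                      trReForm (trBasis N p.2) (((CsDeltaCPstY x (lettersYOfRecordV4 N θ Mstar (resYOfC2 N θ Mstar 𝔠) x)
            (sectEStYOfRecordV7 N θ Mstar (sectEYWithDt2 N θ Mstar (resYOfC2 N θ Mstar 𝔠) 𝔡₂ 𝔢₀) x) U).restrictScalars ℝ)
                        (Pi.single (ι q.1) (trBasis N q.2)) (ι p.1))))⁻¹ :
                    Matrix ↥Λ ↥Λ ℝ) ⟨u, h.1⟩ ⟨w, h.2⟩ else 0]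
            smallFieldSet Λ p) ∧
        ∀ (s : ℕ) (I J : Finset (B1Eq324BenfattoLemma.Site (θ.d₆ + 1 + (θ.d₆ + 1) + 1))) (𝔞 : Coef (θ.d₆ + 1 + (θ.d₆ + 1) + 1)),
          I.Nonempty → J ⊆ I → J ⊆ Λ → coefSup s D 𝔞 J ≤ c * η ^ σ' →
          0 < ∫ z, cutoffBoltzmann (hamiltonian s D ϰ 𝔞 J) I (B10.pFun b₀ p₀ η) z ∂(gaussianFieldOfKernel fun u w => if h : u ∈ Λ ∧ w ∈ Λ then
              ((Matrix.reindex e' e'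
                (Matrix.of fun p q : σ × TrIdx N =>
                    trReForm (trBasis N p.2) (((CsDeltaCPstY x (lettersYOfRecordV4 N θ Mstar (resYOfC2 N θ Mstar 𝔠) x)
            (sectEStYOfRecordV7 N θ Mstar (sectEYWithDt2 N θ Mstar (resYOfC2 N θ Mstar 𝔠) 𝔡₂ 𝔢₀) x) U).restrictScalars ℝ)
                      (Pi.single (ι q.1) (trBasis N q.2)) (ι p.1))))⁻¹ :
                  Matrix ↥Λ ↥Λ ℝ) ⟨u, h.1⟩ ⟨w, h.2⟩ else 0) ∧
            |Real.log (∫ z, cutoffBoltzmann (hamiltonian s D ϰ 𝔞 J) I (B10.pFun b₀ p₀ η) z ∂(gaussianFieldOfKernel fun u w =>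
                if h : u ∈ Λ ∧ w ∈ Λ then
                  ((Matrix.reindex e' e'
                    (Matrix.of fun p q : σ × TrIdx N =>
                        trReForm (trBasis N p.2) (((CsDeltaCPstY x (lettersYOfRecordV4 N θ Mstar (resYOfC2 N θ Mstar 𝔠) x)
            (sectEStYOfRecordV7 N θ Mstar (sectEYWithDt2 N θ Mstar (resYOfC2 N θ Mstar 𝔠) 𝔡₂ 𝔢₀) x) U).restrictScalars ℝ)
                          (Pi.single (ι q.1) (trBasis N q.2)) (ι p.1))))⁻¹ :
                      Matrix ↥Λ ↥Λ ℝ) ⟨u, h.1⟩ ⟨w, h.2⟩ else 0)) -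
              cumulantSum (gaussianFieldOfKernel fun u w => if h : u ∈ Λ ∧ w ∈ Λ then
                  ((Matrix.reindex e' e'
                    (Matrix.of fun p q : σ × TrIdx N =>
                        trReForm (trBasis N p.2) (((CsDeltaCPstY x (lettersYOfRecordV4 N θ Mstar (resYOfC2 N θ Mstar 𝔠) x)
            (sectEStYOfRecordV7 N θ Mstar (sectEYWithDt2 N θ Mstar (resYOfC2 N θ Mstar 𝔠) 𝔡₂ 𝔢₀) x) U).restrictScalars ℝ)
                          (Pi.single (ι q.1) (trBasis N q.2)) (ι p.1))))⁻¹ :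
                      Matrix ↥Λ ↥Λ ℝ) ⟨u, h.1⟩ ⟨w, h.2⟩ else 0)
                (hamiltonian s D ϰ 𝔞 J) t| ≤ C * η ^ κ' * I.card := by
  obtain ⟨b₁, hb₁⟩ := eq324_CsDeltaCPstY_sectEStYOfRecordV7_trBasis_of_small_onΛst_on_unit N θ Mstar (resYOfC2 N θ Mstar 𝔠)
    (sectEYWithDt2 N θ Mstar (resYOfC2 N θ Mstar 𝔠) 𝔡₂ 𝔢₀) hγ₀ hBP (KJadj_nonneg (N := N) (r₂ := r₂) (δ := δ) θ hj₁ hC₂) hδ hδV hsmallV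
    t D hϰ hp₀ hσ hc hκ hκσ
  refine ⟨b₁, fun b₀ hb₀ => ?_⟩
  obtain ⟨C, hC, hE⟩ := hb₁ b₀ hb₀
  refine ⟨C, hC, ?_⟩
  intro η hη hηle x _ G hG U hU hV hCr hDr σ _ _ _ ι hι hιT h3132 S hHJ hDsupp hDloc hDsz hco
  have hUu : ∀ μ z, U μ z ∈ unitaryUnits (Matrix (Fin N) (Fin N) ℂ) := fun μ z => hG (hU μ z)
  exact hE η hη hηle x hG U hU hV (resYOfC2_Δ2_isSymmTr_real θ Mstar 𝔠 x hUu hCr)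
    (sectEYWithDt2_D2J_isSymmTr_ofC2 θ Mstar 𝔠 𝔡₂ 𝔢₀ x hUu hCr hDr) ι hι hιT
    (fun u v hu hv => pRowOnΛst_opsYNuOfRecordV4E_of_ineq3132 θ Mstar (resYOfC2 N θ Mstar 𝔠) 𝔢 𝔴 𝔈 x (θ.d₆ + 1) hBP hδ.le U h3132 hu hv)
    (JRowPrint_sectEYWithDt2_of_adjCurrent_onΛst θ Mstar (resYOfC2 N θ Mstar 𝔠) 𝔡₂ 𝔢₀ hD x U S hj₁ hC₂ hδ.le hHJ hDsupp hDloc hDsz) hco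

end RowsByNameStar

/-! ## §3 The family form at def-Y's CLASS-PARAMETRIC carrier `bg9YR SU(N) R₁ R₂` — p680757 §6 re-keyed at the star letters -/

section ClassParametricStar

open scoped Matrix.Norms.L2Operator
open B7Prop2Explicit (unitaryUnits)
open B7Prop2SpecialUnitary (specialUnitaryUnits specialUnitaryUnits_le_unitaryUnits)
open B9Thm311ReadingCoords (trIP IsSymmTr)
open B9CoReadingCoordsTranspose (trReForm TrIdx trBasis)
open B9Eq3132NuReading (opsYNuOfRecordV4E)
open B9BackgroundsKLevelV1R (RegFamY bg9YR MemOfFam siteKernelR mem_of_reg335R)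

/-- ★★★ **THE FAMILY-FORM STAR DOOR AT THE CLASS-PARAMETRIC CARRIER, SMALL BACKGROUNDS** — p680757 §6
`…PrecisionDoorRowsByName.eq324_CsDeltaCPY_opsYOfRecordV8E_trBasis_of_stmt3132Printed_R_of_adjCurrent_onΛ_on_unit` RE-KEYED AT THE STAR LETTERS: for ANY pair of
regularity families `(R₁, R₂)` on the members (def-Y's `RegFamY`; print's classes (3.35)–(3.36) as PARAMETERS) whose first class is `SU(N)`-valued (`MemOfFam`): if node
N06's row 26 holds at the carrier `bg9YR M_N(ℂ) SU(N) R₁ R₂` for the `ν`-read record over `resYOfC2 𝔠` — the conclusion type of n06-i's `s3132Nu_opsYNuOfRecordV4E_R R₁ R₂`,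
kernels re-typed by def-Y's `siteKernelR R₁ R₂` — then there are print's thresholds `M₄`, `a₀` and ONE rate `δ` such that for every member above `M₄`, every `α₀` with
`Mα₀ ≤ a₀` and every background in the two classes `R₁ x c35 α₀`, `R₂ x c35 α₀`, the star door of §2 holds: DISPLAYED = the small field of the averaged field of record
`‖V(b) − 1‖ ≤ δ_V` (member-uniform numeral `L^{d+1}·2δ_V(L + (d+1)ℓ) < 1` up front), [5]'s reality of `C⁽²⁾(U)`, `D̃⁽²⁾(U)`, (b†) the print-unit sup of the adjoint
current `H₁(U)†J(U)` on a support predicate `S`, (c-out) on STAR pairs, (c) argument locality ∕ size of `D̃⁽²⁾`, the Δ_k-row `γ₀` on print's STAR subspace (G-B9-09).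
`U` is `SU(N)`-valued by `mem_of_reg335R`.
[cite: Balaban1985BackgroundPropagators, (3.35)–(3.36) p.396, (3.40) p.397, (3.132) p.422, (3.136) p.422, Thm 3.12 p.423, p.427, (3.117) p.419, (3.156)–(3.158) p.428;
Balaban1985Averaging, (125)–(126) p.36, (136) p.39; Balaban1984PropagatorsII, (2.3) p.224, Lemma 2.4 p.245, (2.149) p.249, (2.153)–(2.156) pp.249–250; Balaban1985UV3,
(24) p.262, pp.271–272; Balaban1982Higgs1, (3.24) p.616; BenfattoEtAl1978, Lemma (4.5)–(4.7) p.152 (class form; bent window, presentation and coordinates ours)] -/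
theorem eq324_CsDeltaCPstY_sectEStYOfRecordV7_trBasis_of_stmt3132Printed_R_of_adjCurrent_of_small_onΛst_on_unit (N : ℕ) [NeZero N] (θ : Stage3Params)
    (hD : 2 ≤ θ.d₆ + 1) (Mstar : ℕ) (𝔠 : C2Y N θ Mstar) (𝔡₂ : Dt2Y N θ Mstar) (𝔢₀ 𝔢 : SectEY N θ Mstar) (𝔴 : RWEY N θ Mstar) (𝔈 : ExpsY N θ Mstar)
    (R₁ R₂ : RegFamY θ.d₆ θ.ℓ₆ θ.hd' θ.hL' θ.b₀ θ.b₁ Mstar (Matrix (Fin N) (Fin N) ℂ)) (hR : MemOfFam (specialUnitaryUnits (Fin N)) R₁) {c35 : ℝ}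
    (h26 : B9.Stmt3132Printed (θ.d₆ + 1) c35
      (geo9Y (d := θ.d₆) (ℓ := θ.ℓ₆) (hd := θ.hd') (hL := θ.hL') (b₀ := θ.b₀) (b₁ := θ.b₁) (Mstar := Mstar))
      (bg9YR (Matrix (Fin N) (Fin N) ℂ) (specialUnitaryUnits (Fin N)) R₁ R₂)
      (fun x => siteKernelR R₁ R₂ (opsYNuOfRecordV4E N θ Mstar (resYOfC2 N θ Mstar 𝔠) 𝔢 𝔴 𝔈 x).QGQinv)
      (fun x => siteKernelR R₁ R₂ (opsYNuOfRecordV4E N θ Mstar (resYOfC2 N θ Mstar 𝔠) 𝔢 𝔴 𝔈 x).QG1Qinv))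
    {γ₀ δV j₁ C₂ r₂ : ℝ} (hγ₀ : 0 < γ₀) (hδV : 0 ≤ δV) (hj₁ : 0 ≤ j₁) (hC₂ : 0 ≤ C₂)
    (hsmallV : (((θ.ℓ₆ + 1 : ℕ) : ℝ)) ^ (θ.d₆ + 1) * (2 * δV * (((θ.ℓ₆ + 1 : ℕ) + (θ.d₆ + 1) * θ.ℓ₆ : ℕ) : ℝ)) < 1)
    (t D : ℕ) {ϰ : ℝ} (hϰ : 0 < ϰ) {p₀ σ' c κ' : ℝ} (hp₀ : 2 / 3 < p₀) (hσ : 0 < σ') (hc : 0 ≤ c) (hκ : 0 < κ') (hκσ : κ' < σ' * (t + 1)) :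
    ∃ M₄ δ a₀ : ℝ, 0 < M₄ ∧ 0 < δ ∧ 0 < a₀ ∧ ∃ b₁ : ℝ, ∀ b₀ : ℝ, b₁ < b₀ → ∃ C : ℝ, 0 ≤ C ∧ ∀ η : ℝ, 0 < η → η ≤ 1 →
      ∀ (x : MemberY θ.d₆ θ.ℓ₆ θ.hd' θ.hL' θ.b₀ θ.b₁ Mstar) [DecidableEq (IBondY x.toKIdx)], M₄ ≤ (geo9Y x).M →
      ∀ α₀ : ℝ, 0 < α₀ → (geo9Y x).M * α₀ ≤ a₀ →
      ∀ (U : CfgY (Matrix (Fin N) (Fin N) ℂ) x.toKIdx), R₁ x c35 α₀ U → R₂ x c35 α₀ U →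
        (∀ b : UBondY x, ‖((avYOfRecord x U b : (Matrix (Fin N) (Fin N) ℂ)ˣ) : Matrix (Fin N) (Fin N) ℂ) - 1‖ ≤ δV) →
        (∀ A A' : FBondY x.toKIdx → Matrix (Fin N) (Fin N) ℂ, (𝔠 x).form U (star A) (star A') = star ((𝔠 x).form U A A')) →
        (∀ B B' : IBondY x.toKIdx → Matrix (Fin N) (Fin N) ℂ, (𝔡₂ x).form U (star B) (star B') = star ((𝔡₂ x).form U B B')) →
      ∀ {σ : Type} [Fintype σ] [DecidableEq σ] [Nonempty σ] (ι : σ → IBondY x.toKIdx), Function.Injective ι → (∀ s, lamTstY x (ι s)) →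
      ∀ (S : IBondY x.toKIdx → Prop),
        (∀ z, S z → etaDY x * ‖trAdjY (trDualMatY N) ((lettersYOfRecordV4 N θ Mstar (resYOfC2 N θ Mstar 𝔠) x).H₁ U) (JY x.toKIdx U) z‖ ≤ j₁) →
        (∀ (u v : IBondY x.toKIdx) (E a : Matrix (Fin N) (Fin N) ℂ) (z : IBondY x.toKIdx), inΛstY x u → inΛstY x v →
          (𝔡₂ x).form U (Pi.single v E) (Pi.single u a) z ≠ 0 → S z) →
        (∀ (u v : IBondY x.toKIdx) (E a : Matrix (Fin N) (Fin N) ℂ), r₂ < unitDistY x u v → (𝔡₂ x).form U (Pi.single v E) (Pi.single u a) = 0) →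
        (∀ (u v : IBondY x.toKIdx) (E a : Matrix (Fin N) (Fin N) ℂ), ∑ z, ‖(𝔡₂ x).form U (Pi.single v E) (Pi.single u a) z‖ ≤ C₂ * ‖E‖ * ‖a‖) →
        (∀ B : IBondY x.toKIdx → Matrix (Fin N) (Fin N) ℂ, (∀ q, ¬ inΛstY x q → B q = 0) → (∀ q, IsAxialY x q → B q = 0) →
          (∀ c' : CBondStY x, Q1Y x (avYOfRecord x) U c'.1 B = 0) →
          γ₀ * trIP (fun _ => (1 : ℝ)) B B ≤
            trIP (fun _ => (1 : ℝ)) B (deltaKPstY x (lettersYOfRecordV4 N θ Mstar (resYOfC2 N θ Mstar 𝔠) x)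
              (sectEStYOfRecordV7 N θ Mstar (sectEYWithDt2 N θ Mstar (resYOfC2 N θ Mstar 𝔠) 𝔡₂ 𝔢₀) x) U B)) →
      ∃ (Λ : Finset (B1Eq324BenfattoLemma.Site (θ.d₆ + 1 + (θ.d₆ + 1) + 1))) (e' : σ × TrIdx N ≃ ↥Λ),
        ((gaussianFieldOfKernel fun u w => if h : u ∈ Λ ∧ w ∈ Λ then
            ((Matrix.reindex e' e'
              (Matrix.of fun p q : σ × TrIdx N =>
                  trReForm (trBasis N p.2) (((CsDeltaCPstY x (lettersYOfRecordV4 N θ Mstar (resYOfC2 N θ Mstar 𝔠) x)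
            (sectEStYOfRecordV7 N θ Mstar (sectEYWithDt2 N θ Mstar (resYOfC2 N θ Mstar 𝔠) 𝔡₂ 𝔢₀) x) U).restrictScalars ℝ)
                    (Pi.single (ι q.1) (trBasis N q.2)) (ι p.1))))⁻¹ :
                Matrix ↥Λ ↥Λ ℝ) ⟨u, h.1⟩ ⟨w, h.2⟩ else 0).map
            (fun (z : B1Eq324BenfattoLemma.Site (θ.d₆ + 1 + (θ.d₆ + 1) + 1) → ℝ) (q : σ × TrIdx N) => z ((e' q : ↥Λ) : B1Eq324BenfattoLemma.Site (θ.d₆ + 1 + (θ.d₆ + 1) + 1))) =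
          gaussianFieldOfKernel fun p q =>
            ((Matrix.of fun p q : σ × TrIdx N =>
                trReForm (trBasis N p.2) (((CsDeltaCPstY x (lettersYOfRecordV4 N θ Mstar (resYOfC2 N θ Mstar 𝔠) x)
            (sectEStYOfRecordV7 N θ Mstar (sectEYWithDt2 N θ Mstar (resYOfC2 N θ Mstar 𝔠) 𝔡₂ 𝔢₀) x) U).restrictScalars ℝ)
                  (Pi.single (ι q.1) (trBasis N q.2)) (ι p.1)))⁻¹ :
              Matrix (σ × TrIdx N) (σ × TrIdx N) ℝ) p q) ∧
        (∀ p : ℝ, 0 ≤ p →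
          ((fun (z : B1Eq324BenfattoLemma.Site (θ.d₆ + 1 + (θ.d₆ + 1) + 1) → ℝ) (q : σ × TrIdx N) => z ((e' q : ↥Λ) : B1Eq324BenfattoLemma.Site (θ.d₆ + 1 + (θ.d₆ + 1) + 1))) ⁻¹'
              {ω : σ × TrIdx N → ℝ | ∀ q, |ω q| ≤ p}) =ᵐ[gaussianFieldOfKernel fun u w => if h : u ∈ Λ ∧ w ∈ Λ then
                ((Matrix.reindex e' e'
                  (Matrix.of fun p q : σ × TrIdx N =>
                      trReForm (trBasis N p.2) (((CsDeltaCPstY x (lettersYOfRecordV4 N θ Mstar (resYOfC2 N θ Mstar 𝔠) x)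
            (sectEStYOfRecordV7 N θ Mstar (sectEYWithDt2 N θ Mstar (resYOfC2 N θ Mstar 𝔠) 𝔡₂ 𝔢₀) x) U).restrictScalars ℝ)
                        (Pi.single (ι q.1) (trBasis N q.2)) (ι p.1))))⁻¹ :
                    Matrix ↥Λ ↥Λ ℝ) ⟨u, h.1⟩ ⟨w, h.2⟩ else 0]
            smallFieldSet Λ p) ∧
        ∀ (s : ℕ) (I J : Finset (B1Eq324BenfattoLemma.Site (θ.d₆ + 1 + (θ.d₆ + 1) + 1))) (𝔞 : Coef (θ.d₆ + 1 + (θ.d₆ + 1) + 1)),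
          I.Nonempty → J ⊆ I → J ⊆ Λ → coefSup s D 𝔞 J ≤ c * η ^ σ' →
          0 < ∫ z, cutoffBoltzmann (hamiltonian s D ϰ 𝔞 J) I (B10.pFun b₀ p₀ η) z ∂(gaussianFieldOfKernel fun u w => if h : u ∈ Λ ∧ w ∈ Λ then
              ((Matrix.reindex e' e'
                (Matrix.of fun p q : σ × TrIdx N =>
                    trReForm (trBasis N p.2) (((CsDeltaCPstY x (lettersYOfRecordV4 N θ Mstar (resYOfC2 N θ Mstar 𝔠) x)
            (sectEStYOfRecordV7 N θ Mstar (sectEYWithDt2 N θ Mstar (resYOfC2 N θ Mstar 𝔠) 𝔡₂ 𝔢₀) x) U).restrictScalars ℝ)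
                      (Pi.single (ι q.1) (trBasis N q.2)) (ι p.1))))⁻¹ :
                  Matrix ↥Λ ↥Λ ℝ) ⟨u, h.1⟩ ⟨w, h.2⟩ else 0) ∧
            |Real.log (∫ z, cutoffBoltzmann (hamiltonian s D ϰ 𝔞 J) I (B10.pFun b₀ p₀ η) z ∂(gaussianFieldOfKernel fun u w =>
                if h : u ∈ Λ ∧ w ∈ Λ then
                  ((Matrix.reindex e' e'
                    (Matrix.of fun p q : σ × TrIdx N =>
                        trReForm (trBasis N p.2) (((CsDeltaCPstY x (lettersYOfRecordV4 N θ Mstar (resYOfC2 N θ Mstar 𝔠) x)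
            (sectEStYOfRecordV7 N θ Mstar (sectEYWithDt2 N θ Mstar (resYOfC2 N θ Mstar 𝔠) 𝔡₂ 𝔢₀) x) U).restrictScalars ℝ)
                          (Pi.single (ι q.1) (trBasis N q.2)) (ι p.1))))⁻¹ :
                      Matrix ↥Λ ↥Λ ℝ) ⟨u, h.1⟩ ⟨w, h.2⟩ else 0)) -
              cumulantSum (gaussianFieldOfKernel fun u w => if h : u ∈ Λ ∧ w ∈ Λ then
                  ((Matrix.reindex e' e'
                    (Matrix.of fun p q : σ × TrIdx N =>
                        trReForm (trBasis N p.2) (((CsDeltaCPstY x (lettersYOfRecordV4 N θ Mstar (resYOfC2 N θ Mstar 𝔠) x)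
            (sectEStYOfRecordV7 N θ Mstar (sectEYWithDt2 N θ Mstar (resYOfC2 N θ Mstar 𝔠) 𝔡₂ 𝔢₀) x) U).restrictScalars ℝ)
                          (Pi.single (ι q.1) (trBasis N q.2)) (ι p.1))))⁻¹ :
                      Matrix ↥Λ ↥Λ ℝ) ⟨u, h.1⟩ ⟨w, h.2⟩ else 0)
                (hamiltonian s D ϰ 𝔞 J) t| ≤ C * η ^ κ' * I.card := by
  obtain ⟨M₄, δ, a₀, BP, hM₄, hδ, ha₀, hBP, H⟩ := h26
  obtain ⟨b₁, hb₁⟩ := eq324_CsDeltaCPstY_sectEStYOfRecordV7_trBasis_of_ineq3132_of_adjCurrent_of_small_onΛst_on_unit N θ hD Mstar 𝔠 𝔡₂ 𝔢₀ 𝔢 𝔴 𝔈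
    (r₂ := r₂) hγ₀ hBP.le hδ hδV hj₁ hC₂ hsmallV t D hϰ hp₀ hσ hc hκ hκσ
  refine ⟨M₄, δ, a₀, hM₄, hδ, ha₀, b₁, fun b₀ hb₀ => ?_⟩
  obtain ⟨C, hC, hE⟩ := hb₁ b₀ hb₀
  refine ⟨C, hC, ?_⟩
  intro η hη hηle x _ hMx α₀ hα₀ hMa U h1 h2 hV hCr hDr σ _ _ _ ι hι hιT S hHJ hDsupp hDloc hDsz hco
  exact hE η hη hηle x specialUnitaryUnits_le_unitaryUnits U (mem_of_reg335R (R₂ := R₂) hR x (U := U) h1) hV hCr hDr ι hι hιT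
    (H x hMx α₀ hα₀ hMa U h1 h2).2 S hHJ hDsupp hDloc hDsz hco

end ClassParametricStar

end Literature.MathematicalPhysics.QuantumFieldTheory.Balaban1983to89.B1Eq324BenfattoClassSectEMemberPrecisionDoorRowsByNameStar

end
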